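import Summits.CriticalPhenomena.Ising3D.IsingColumnFaceL11
import Summits.CriticalPhenomena.Ising3D.TaylorRegionBoxInputs
import Summits.CriticalPhenomena.Ising3D.TaylorCertificateObligations
import Literature.MathematicalPhysics.QuantumFieldTheory.ConformalBootstrap3D.BlockZSeriesABOfLt
import Literature.MathematicalPhysics.QuantumFieldTheory.ConformalBootstrap3D.MeanFieldDecompositionAB
import HarnessLib

/-!
# F-CP1 statement-first typing: the Λ = 11 exclusion STRIP `IsingEnclosure W₁₁ (B₁₁ ∪ S₁₁^□)` and the
# conditional Λ ≥ 19 ISLAND `IsingEnclosure W₁₉ B₁₉`, as kernel shapes modulo named certificate hypotheses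
(cell `crit-ising-boot`, seat typing-1; PRE-REG v5 sha16 `b8848a1d5c9e4d5a` §(1a)/(1b), §(4) row 7 — v5 = v2
`6a0217a727ae8a93` numbers + AMEND-5 (wording) + AMEND-6 (un-excluded set `U₁₁ := B₁₁ ∪ S₁₁^□` inside the
envelope `S₁₁⁺`) + AMEND-7 (criterion definitions); director's DAY-0 standing instruction (a): the typed statement
lands BEFORE any certificate run. Nothing in this file is a certificate.)

HONEST FRAMING: lottery ticket; floor = tightest certified 3D Ising CFT bounds; floating SDPB islands, however
precise, are not certificates; nothing is called certified that is not kernel- or interval/exact-certified at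
the stated standard; no exact-solution or exact-exponent claim; not a determination of `Δσ, Δε` beyond
«inside `B₁₁ ∪ S₁₁^□` (resp. `B₁₉`) given A1–A4 at order Λ».

STATUS OF THE THEOREMS: `isingStrip_L11`, `isingStrip_L11_envelope`, `isingIsland_L19` are CONDITIONAL on their
hypothesis structure — on the cover's `excluded` fields (one S3- or S2-discharged `BoxExcluded` per tile) and on
the cover / staircase fields; the kernel proves only the cover step. They are never to be reported as «proved»
strip / island theorems. No hypothesis structure is trivially available: the empty cover is refuted for every
staircase (`not_stripCertificatesL11_nil_cover`), the staircase is never empty (`StripCertificatesL11.stair_ne_nil`),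
an island cover is never empty (`IslandCertificatesL19.cover_ne_nil`).

WHAT IS TYPED (exact rational literals, PRE-REG v5 §(1a)/(1b) verbatim; strip objects in `StripL11`):
* `W₁₁ := [101/200, 107/200] × [6/5, 8/5]`, `B₁₁ := [263/512, 67/128] × [89/64, 185/128]`, the ridge band of record
  `S₁₁ := {p ∈ W₁₁ | p.1 ≥ 521/1000 ∧ |p.2 − (36/25 + (24/5)(p.1 − 209/400))| ≤ 3/100}`, its pre-registered ENVELOPE
  `S₁₁plus` (cut `519/1000`, half-width `1/25`; AMEND-6) — both bands declared OPEN (`W`-dependent, NOT claimed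
  excluded) — and the TARGET band `U₁₁ := B₁₁ ∪ S₁₁`, kept ONLY as the target: `IsingEnclosure W₁₁ U₁₁` is NOT
  claimed and no theorem concludes it (referee-1 F1: no finite axis-parallel closed cover of `W₁₁ \ U₁₁` avoids
  the open slanted `S₁₁`). All `Set (ℝ × ℝ)`.
* `StripCertificatesL11 stair cover` — hypothesis structure in the shape of `ColumnFaceL11.ColumnCertificatesL11`,
  PARAMETRIC in the lead's hash-rowed dyadic STAIRCASE `stair : List BoxQ` (`S₁₁^□ = ⋃ stair`) and in the producers'
  finite cover `cover : List BoxQ` (`BoxQ` = the tree's rational box, `TaylorRegionBoxInputs`, reused; rational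
  corners — dyadicity is the producers' format, not a logical need). Fields `stair_sup : S₁₁ ⊆ ⋃ stair`,
  `stair_sub : ⋃ stair ⊆ S₁₁plus`, `covers : W₁₁ \ (B₁₁ ∪ ⋃ stair) ⊆ ⋃ cover` (all three exact rational arithmetic
  once the lists are fixed — kernel-decidable by certificate, sibling `IsingStripL11Cover`) and
  `excluded : ∀ Q ∈ cover, BoxExcluded Q` (one Λ = 11 certificate per tile). Both lists are hash-rowed only before
  their runs (PRE-REG §(2) K3), hence PARAMETERS: no re-typing when tiles coarsen; a generated record structure
  with one named field per certificate (sha256 in the docstring, as in `ColumnCertificatesL11`) instantiates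
  `StripCertificatesL11 stairOfRecord coverOfRecord` (pattern: `IsingStripL11Instances.columnTiles_excluded`).
* `isingStrip_L11 : StripCertificatesL11 stair cover → IsingEnclosure W₁₁ (B₁₁ ∪ ⋃ stair)` — the fine statement,
  assembled by the tree's `isingEnclosure_of_cover` exactly as `isingColumnFace_L11` was; the reader-facing
  ENVELOPE COROLLARY `isingStrip_L11_envelope : … → IsingEnclosure W₁₁ (B₁₁ ∪ S₁₁plus)` by `IsingEnclosure.mono`;
  the interim shape `isingStrip_L11_of_cover : … → IsingEnclosure W₁₁ U` for the hash-rowed `U` of any date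
  (faces are certified inward; a retreat is a dated FINDING; `W₁₁`, `B₁₁`, `S₁₁`, `S₁₁plus` are never edited here).
* `IslandCertificatesL19 W₁₉ B₁₉ cover`, `isingIsland_L19 : … → IsingEnclosure W₁₉.toSet B₁₉.toSet`, with
  `W₁₉ B₁₉ : BoxQ` PARAMETERS (hash-rowed by the owner at K2, not here; the K2 instance adds the non-degeneracy
  guard `B₁₉.σlo ≤ B₁₉.σhi ∧ B₁₉.εlo ≤ B₁₉.εhi` by `norm_num`) and the side condition `B₁₉.StrictInside W₁₉`
  (`∂B₁₉ ⊂ interior W₁₉`: all four sides are faces — `IslandCertificatesL19.island_subset_interior`).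
* A-mix := `SigmaEpsilonData.SatisfiesBootstrapAxioms` (A1–A4, `SigmaEpsilonSystem`) VERBATIM through
  `BoxExcluded` / `IsingEnclosure`: NO `λσσε = λσεσ`, NO θ-scan, NO stress-tensor / twist-gap input; a stronger
  predicate only on the owner's request (none declared).
VACUITY GUARDS (more in `IsingStripL11Instances`): `S₁₁ ⊆ S₁₁plus ⊆ W₁₁`, `U₁₁ ⊆ W₁₁`, `B₁₁ ∩ S₁₁ ≠ ∅`, `S₁₁`
reaches `∂W₁₁`; `(101/200, 6/5) ∈ W₁₁ \ (B₁₁ ∪ S₁₁plus)`; A1–A4 satisfiable (`gffLine_satisfiesBootstrapAxioms`)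
with every known satisfying family outside `W₁₁` (`IsingStripL11Instances.gff_witnesses_not_mem_W₁₁`) — the
strip statement is neither vacuous nor refuted by the tree.
CONSISTENCY NOTE (owner 2026-08-28T17:01:56Z): of the certified column face of record (`isingColumnFace_L11`,
42/42 U-1 PASS at S3) the segment `σcell × [89/64, 2855/2048]` lies INSIDE `B₁₁` — the strip theorem claims less
there — and `σcell × [81/64, 89/64)` lies in `W₁₁ \ (B₁₁ ∪ S₁₁plus)` (`σcell`'s `Δσ < 519/1000`), hence outside
`B₁₁ ∪ S₁₁^□` for every admissible staircase (`IsingStripL11Instances`: `colBox_face_subset_B₁₁`,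
`colBox_low_subset_diff(_stair)`).
RESIDUALS T1 / T4-A AS LEAN LEGS (AMEND-5: «residuals = the S3 hypotheses; T1/T4-A are kernel theorems»): T1
(typed block = Dolan–Osborn / Hogervorst–Rychkov `z`-series over κ, all `(a, b)`, every admissible `(Δ, ℓ)`) is
`SatisfiesBootstrapAxioms.gp_eq_hrBlock / gpm_eq_hrBlockAB / gmm_eq_hrBlockAB` (`BlockUniquenessLimit`) and
`IsConformalBlock3D.hasSum_hrZTerm_of_isAdmissible / hasSum_hrZTermAB(_neg)_of_lt` (`BlockZSeriesABOfLt`); T4-A is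
`appliesTermwise_of_isTaylorAt_of_axioms` (`DerivativeFunctionalTermwise`). Packaged on `W₁₁`, where their side
conditions `Δσ ≠ Δε`, `4Δσε² ≠ 1`, `Δσ ≠ 1`, `Δσ < 1 < Δσ + 1/2 < Δε` hold, as `blocks_eq_hrBlock_of_mem_W₁₁`,
`blocks_hasSum_zSeries_of_mem_W₁₁`, `boxExcluded_of_obligations_of_subset_W₁₁` — unconditional; NO `Prop`
hypothesis is introduced. The honest residual of an S3 face is its list of S3 `BoxExcluded` hypotheses, nothing
block-theoretic. Sources of the shapes: Kos–Poland–Simmons-Duffin, JHEP 11 (2014) 109, §3.3 eq. (3.16), §4,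
§5.3; Dolan–Osborn, Nucl. Phys. B 678 (2004) 491, §3.
WHAT THIS FILE SHOWS BY ITSELF about the 3D Ising CFT: nothing beyond «the cover step is right». No tile, no
staircase box, no certificate, no number of any run appears here. [folklore]
-/

namespace Summit.CriticalPhenomena.Ising3D

open Set Literature.MathematicalPhysics.QuantumFieldTheory.ConformalBootstrap3D

/-! ### Generic: enclosure from a finite list of excluded rational boxes -/

/-- **Cover assembly over a finite list of rational boxes.** If `W \ R` is covered by the boxes of `cover`
and every box of `cover` is excluded, then `IsingEnclosure W R` — the tree's `isingEnclosure_of_cover`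
indexed by the members of the list. [folklore] -/
theorem isingEnclosure_of_boxCover {W R : Set (ℝ × ℝ)} (cover : List BoxQ)
    (hcov : W \ R ⊆ ⋃ Q ∈ cover, Q.toSet) (hQ : ∀ Q ∈ cover, BoxExcluded Q.toSet) :
    IsingEnclosure W R := by
  refine isingEnclosure_of_cover (fun Q : {Q // Q ∈ cover} => Q.1.toSet) (fun p hp => ?_)
    (fun Q => hQ Q.1 Q.2)
  by_cases hR : p ∈ R
  · exact Or.inl hR
  · have h := hcov ⟨hp, hR⟩
    rw [mem_iUnion₂] at h
    obtain ⟨Q, hQm, hpQ⟩ := h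
    exact Or.inr (mem_iUnion.mpr ⟨⟨Q, hQm⟩, hpQ⟩)

/-- A rational box `B` lies STRICTLY INSIDE a rational box `W`: every edge of `B` is strictly between the
corresponding edges of `W` (four strict rational inequalities; `by norm_num [BoxQ.StrictInside]` decides it
on literals). This is the stated side condition «`∂B₁₉ ⊂ interior W₁₉`» of PRE-REG §(1b). [folklore] -/
@[folklore] def BoxQ.StrictInside (B W : BoxQ) : Prop :=
  W.σlo < B.σlo ∧ B.σhi < W.σhi ∧ W.εlo < B.εlo ∧ B.εhi < W.εhi

/-- A strictly-inside box lies in the OPEN box of `W`. [folklore] -/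
theorem BoxQ.StrictInside.toSet_subset_Ioo {B W : BoxQ} (h : B.StrictInside W) :
    B.toSet ⊆ Ioo (W.σlo : ℝ) W.σhi ×ˢ Ioo (W.εlo : ℝ) W.εhi := by
  rintro ⟨σ, ε⟩ hp
  obtain ⟨h1, h2, h3, h4⟩ := BoxQ.bounds hp
  obtain ⟨g1, g2, g3, g4⟩ := h
  have g1' : ((W.σlo : ℚ) : ℝ) < B.σlo := by exact_mod_cast g1
  have g2' : ((B.σhi : ℚ) : ℝ) < W.σhi := by exact_mod_cast g2
  have g3' : ((W.εlo : ℚ) : ℝ) < B.εlo := by exact_mod_cast g3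
  have g4' : ((B.εhi : ℚ) : ℝ) < W.εhi := by exact_mod_cast g4
  exact ⟨⟨by linarith, by linarith⟩, ⟨by linarith, by linarith⟩⟩

/-- Hence a strictly-inside box lies in the INTERIOR of `W`: its whole boundary is interior to the window,
i.e. all four sides of `B` are faces to be certified (a closed curve). [folklore] -/
theorem BoxQ.StrictInside.toSet_subset_interior {B W : BoxQ} (h : B.StrictInside W) :
    B.toSet ⊆ interior W.toSet :=
  h.toSet_subset_Ioo.trans ((isOpen_Ioo.prod isOpen_Ioo).subset_interior_iff.mpr
    (prod_mono Ioo_subset_Icc_self Ioo_subset_Icc_self))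

/-! ### The Λ ≥ 19 island shape (conditional on PRE-REG §(5) + K2; `W₁₉`, `B₁₉` are parameters) -/

/-- **The island certificates as HYPOTHESES, parametric in the geometry and the tiling.** `W₁₉`, `B₁₉` are
rational boxes fixed by the owner's hash row at K2 (outward-rounded dyadics ⊇ the mp-float Λ = 19 island + a
measured collar) BEFORE any certificate run; they are NOT chosen in this file. Fields: the stated side
condition `B₁₉` strictly inside `W₁₉` (all four sides are faces); the cover obligation of the finite tiling;
one `BoxExcluded` per tile = one Λ = 19 derivative-functional certificate (mp producer in cert mode, rounded
to exact dyadics; format `ising3d-cert-v1` at Λ = 19, |L| = 110 pairs, dim α = 275) at standard S3 or S2,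
under A-mix = `SatisfiesBootstrapAxioms` (A1–A4) verbatim — no OPE-coefficient relation, no θ-scan. A
bookkeeping definition; nothing is asserted. [folklore] -/
@[folklore] structure IslandCertificatesL19 (W₁₉ B₁₉ : BoxQ) (cover : List BoxQ) : Prop where
  /-- Side condition of PRE-REG §(1b): `∂B₁₉ ⊂ interior W₁₉`. -/
  strictInside : B₁₉.StrictInside W₁₉
  /-- Cover obligation: the tiles cover `W₁₉ \ B₁₉` (rational arithmetic once the tiling is fixed). -/
  covers : W₁₉.toSet \ B₁₉.toSet ⊆ ⋃ Q ∈ cover, Q.toSet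
  /-- One Λ = 19 certificate per tile. -/
  excluded : ∀ Q ∈ cover, BoxExcluded Q.toSet

/-- **The conditional Λ ≥ 19 ISLAND, assembled modulo its certificates** (PRE-REG v2 §(1b)): under
`IslandCertificatesL19 W₁₉ B₁₉ cover`, every σ–ε datum satisfying A1–A4 with `(Δσ, Δε) ∈ W₁₉` has
`(Δσ, Δε) ∈ B₁₉`. Certified exclusion region at stated derivative order and assumptions; not a
determination of the 3D Ising critical exponents beyond that. [folklore] -/
theorem isingIsland_L19 {W₁₉ B₁₉ : BoxQ} {cover : List BoxQ} (h : IslandCertificatesL19 W₁₉ B₁₉ cover) :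
    IsingEnclosure W₁₉.toSet B₁₉.toSet :=
  isingEnclosure_of_boxCover cover h.covers h.excluded

/-- The side condition read topologically: `B₁₉ ⊆ interior W₁₉`. [folklore] -/
theorem IslandCertificatesL19.island_subset_interior {W₁₉ B₁₉ : BoxQ} {cover : List BoxQ}
    (h : IslandCertificatesL19 W₁₉ B₁₉ cover) : B₁₉.toSet ⊆ interior W₁₉.toSet :=
  h.strictInside.toSet_subset_interior

/-- Guard: on a non-degenerate window the cover cannot be empty (the corner `(W.σlo, W.εlo)` lies in
`W₁₉ \ B₁₉`), so the `covers` field has content. [folklore] -/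
theorem IslandCertificatesL19.cover_ne_nil {W₁₉ B₁₉ : BoxQ} {cover : List BoxQ}
    (h : IslandCertificatesL19 W₁₉ B₁₉ cover) (hσ : W₁₉.σlo ≤ W₁₉.σhi) (hε : W₁₉.εlo ≤ W₁₉.εhi) :
    cover ≠ [] := by
  intro hnil
  have hc : ((W₁₉.σlo : ℝ), (W₁₉.εlo : ℝ)) ∈ W₁₉.toSet \ B₁₉.toSet := by
    refine ⟨mk_mem_prod ⟨le_rfl, by exact_mod_cast hσ⟩ ⟨le_rfl, by exact_mod_cast hε⟩, fun hB => ?_⟩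
    obtain ⟨h1, -, -, -⟩ := BoxQ.bounds hB
    have g1 : ((W₁₉.σlo : ℚ) : ℝ) < B₁₉.σlo := by exact_mod_cast h.strictInside.1
    exact absurd h1 (not_le.mpr g1)
  have := h.covers hc
  rw [hnil] at this
  simp at this

namespace StripL11

/-! ### The exact sets of PRE-REG v2 §(1a) -/

/-- The Λ = 11 strip WINDOW `W₁₁ := [101/200, 107/200] × [6/5, 8/5]` (= the phase-0 window
`[0.505, 0.535] × [1.2, 1.6]`). [folklore] -/
def W₁₁ : Set (ℝ × ℝ) := Icc (101 / 200 : ℝ) (107 / 200) ×ˢ Icc (6 / 5 : ℝ) (8 / 5)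

/-- The committed INNER BOX `B₁₁ := [263/512, 67/128] × [89/64, 185/128]`
(= `[0.513671875, 0.5234375] × [1.390625, 1.4453125]`: outward-rounded dyadics ⊇ the Λ = 11 float bbox with
the pre-registered collars). Never moved silently (PRE-REG §(1a), K3). [folklore] -/
def B₁₁ : Set (ℝ × ℝ) := Icc (263 / 512 : ℝ) (67 / 128) ×ˢ Icc (89 / 64 : ℝ) (185 / 128)

/-- The ridge STRIP of record
`S₁₁ := {(Δσ, Δε) ∈ W₁₁ : Δσ ≥ 521/1000 ∧ |Δε − (36/25 + (24/5)(Δσ − 209/400))| ≤ 3/100}`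
(SCOPE.md l.56, slope 24/5 as printed there) — declared OPEN: `W`-dependent, NOT claimed excluded.
[folklore] -/
def S₁₁ : Set (ℝ × ℝ) :=
  {p ∈ W₁₁ | (521 / 1000 : ℝ) ≤ p.1 ∧ |p.2 - (36 / 25 + 24 / 5 * (p.1 - 209 / 400))| ≤ 3 / 100}

/-- The pre-registered ENVELOPE band
`S₁₁⁺ := {(Δσ, Δε) ∈ W₁₁ : Δσ ≥ 519/1000 ∧ |Δε − (36/25 + (24/5)(Δσ − 209/400))| ≤ 1/25}` (AMEND-6): the
hash-rowed dyadic staircase `S₁₁^□` of the theorem of record satisfies `S₁₁ ⊆ S₁₁^□ ⊆ S₁₁⁺`. Declared OPEN,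
not claimed excluded. [folklore] -/
def S₁₁plus : Set (ℝ × ℝ) :=
  {p ∈ W₁₁ | (519 / 1000 : ℝ) ≤ p.1 ∧ |p.2 - (36 / 25 + 24 / 5 * (p.1 - 209 / 400))| ≤ 1 / 25}

/-- The pre-registered TARGET band `U₁₁ := B₁₁ ∪ S₁₁` — kept ONLY as the target: `S₁₁ ⊆` the certified
un-excluded staircase `⊆ S₁₁plus`; `IsingEnclosure W₁₁ U₁₁` itself is NOT claimed and no theorem of this file
concludes it (referee-1 F1: no axis-parallel finite closed cover of `W₁₁ \ U₁₁` avoids the open `S₁₁`).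
[folklore] -/
def U₁₁ : Set (ℝ × ℝ) := B₁₁ ∪ S₁₁

/-! ### The strip hypothesis structure and the assembled theorems -/

/-- **The Λ = 11 strip certificates as HYPOTHESES, parametric in the staircase and the tiling.** `stair` is the
lead's hash-rowed dyadic staircase (`S₁₁^□ := ⋃ Q ∈ stair, Q`; corners in `(2⁻¹¹ℤ)²` or on `∂W₁₁` by the page's
format), `cover` the finite list of the producers' rational tiles of `W₁₁ \ (B₁₁ ∪ S₁₁^□)` (adaptive; classes
2⁻⁶…2⁻¹² expected **[est]**), both fixed by hash row before any run and hence PARAMETERS. Fields: `stair_sup` /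
`stair_sub` — the staircase is pinned between the pre-registered bands, `S₁₁ ⊆ S₁₁^□ ⊆ S₁₁plus` (exact rational
arithmetic once the list is fixed); `covers` — the cover obligation `W₁₁ \ (B₁₁ ∪ S₁₁^□) ⊆ ⋃ cover` (tiles are
closed and may share sides with `∂B₁₁`, `∂S₁₁^□`; idem); `excluded` — each tile is excluded: the content of one
kind-`deriv` Λ = 11 certificate (format `ising3d-cert-v1`, 105 exact dyadic components, obligations O0–O7 +
addenda B/C/R) at standard S3 or S2 (kernel replay, `boxExcluded_of_obligations_of_subset_W₁₁`), under A-mix =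
`SatisfiesBootstrapAxioms` verbatim. Shape of `ColumnCertificatesL11`; bookkeeping; nothing is asserted. [folklore] -/
@[folklore] structure StripCertificatesL11 (stair cover : List BoxQ) : Prop where
  /-- The staircase covers the ridge band of record: `S₁₁ ⊆ S₁₁^□`. -/
  stair_sup : S₁₁ ⊆ ⋃ Q ∈ stair, Q.toSet
  /-- The staircase stays inside the pre-registered envelope: `S₁₁^□ ⊆ S₁₁plus`. -/
  stair_sub : (⋃ Q ∈ stair, Q.toSet) ⊆ S₁₁plus
  /-- Cover obligation: the tiles cover `W₁₁ \ (B₁₁ ∪ S₁₁^□)`. -/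
  covers : W₁₁ \ (B₁₁ ∪ ⋃ Q ∈ stair, Q.toSet) ⊆ ⋃ Q ∈ cover, Q.toSet
  /-- One Λ = 11 certificate per tile. -/
  excluded : ∀ Q ∈ cover, BoxExcluded Q.toSet

/-- **The Λ = 11 certified STRIP, assembled modulo its certificates — the fine (staircase) statement**
(PRE-REG v5 §(1a)): under `StripCertificatesL11 stair cover`, every σ–ε bootstrap datum satisfying A-mix = A1–A4
with `(Δσ, Δε) ∈ W₁₁` has `(Δσ, Δε) ∈ B₁₁ ∪ S₁₁^□`. Assembled by `isingEnclosure_of_cover`, as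
`isingColumnFace_L11` was. Certified exclusion region at stated derivative order (Λ = 11) and assumptions (A1–A4);
the staircase is open along the ridge; not a determination of the 3D Ising critical exponents beyond that.
[folklore] -/
theorem isingStrip_L11 {stair cover : List BoxQ} (h : StripCertificatesL11 stair cover) :
    IsingEnclosure W₁₁ (B₁₁ ∪ ⋃ Q ∈ stair, Q.toSet) :=
  isingEnclosure_of_boxCover cover h.covers h.excluded

/-- **The ENVELOPE COROLLARY — the staircase-free statement a reader cites** (PRE-REG v5 §(1a), AMEND-6): under
`StripCertificatesL11 stair cover`, every σ–ε bootstrap datum satisfying A1–A4 with `(Δσ, Δε) ∈ W₁₁` has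
`(Δσ, Δε) ∈ B₁₁ ∪ S₁₁plus` — by `IsingEnclosure.mono` from the fine statement and `stair_sub`. Same honest status.
[folklore] -/
theorem isingStrip_L11_envelope {stair cover : List BoxQ} (h : StripCertificatesL11 stair cover) :
    IsingEnclosure W₁₁ (B₁₁ ∪ S₁₁plus) :=
  (isingStrip_L11 h).mono Subset.rfl (union_subset_union_right B₁₁ h.stair_sub)

/-- **Interim shape** (PRE-REG §(1a): «the theorem of record at any date is `IsingEnclosure W₁₁ U` for the
hash-rowed un-excluded set `U ⊇ U₁₁` of that date»): any finite excluded cover of `W₁₁ \ U` gives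
`IsingEnclosure W₁₁ U`. Here `U` is NOT a free choice: it must be HASH-ROWED before the cover's first certificate
run, and any change of `U` is a dated FINDING line on the cell bus (page §(1a), K3) — `IsingEnclosure.mono` then
moves between dated `U`'s. [folklore] -/
theorem isingStrip_L11_of_cover {U : Set (ℝ × ℝ)} (cover : List BoxQ)
    (hcov : W₁₁ \ U ⊆ ⋃ Q ∈ cover, Q.toSet) (hQ : ∀ Q ∈ cover, BoxExcluded Q.toSet) :
    IsingEnclosure W₁₁ U :=
  isingEnclosure_of_boxCover cover hcov hQ

/-! ### Vacuity guards on the geometry -/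

/-- `B₁₁ ⊆ W₁₁`. [folklore] -/
theorem B₁₁_subset_W₁₁ : B₁₁ ⊆ W₁₁ := by
  rintro ⟨σ, ε⟩ ⟨⟨h1, h2⟩, h3, h4⟩
  exact ⟨⟨by linarith, by linarith⟩, by linarith, by linarith⟩

/-- `S₁₁ ⊆ W₁₁` (by definition). [folklore] -/
theorem S₁₁_subset_W₁₁ : S₁₁ ⊆ W₁₁ := fun _ hp => hp.1

/-- `S₁₁plus ⊆ W₁₁` (by definition). [folklore] -/
theorem S₁₁plus_subset_W₁₁ : S₁₁plus ⊆ W₁₁ := fun _ hp => hp.1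

/-- The band of record lies in its envelope: `S₁₁ ⊆ S₁₁plus` (`521/1000 ≥ 519/1000`, `3/100 ≤ 1/25`). [folklore] -/
theorem S₁₁_subset_S₁₁plus : S₁₁ ⊆ S₁₁plus := by
  rintro p ⟨hW, h1, h2⟩
  exact ⟨hW, le_trans (by norm_num) h1, le_trans h2 (by norm_num)⟩

/-- `U₁₁ ⊆ W₁₁`. [folklore] -/
theorem U₁₁_subset_W₁₁ : U₁₁ ⊆ W₁₁ := union_subset B₁₁_subset_W₁₁ S₁₁_subset_W₁₁

/-- `B₁₁` and `S₁₁` overlap: the ridge point `(209/400, 36/25)` lies in both (`U₁₁` is one piece).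
[folklore] -/
theorem ridgePoint_mem_inter : ((209 / 400 : ℝ), (36 / 25 : ℝ)) ∈ B₁₁ ∩ S₁₁ := by
  refine ⟨⟨⟨by norm_num, by norm_num⟩, ⟨by norm_num, by norm_num⟩⟩,
    ⟨⟨⟨by norm_num, by norm_num⟩, ⟨by norm_num, by norm_num⟩⟩, by norm_num, ?_⟩⟩
  norm_num

/-- `S₁₁` reaches the right edge of the window: `(107/200, 3/2) ∈ S₁₁` (the strip is open towards the bulk
allowed region, as pre-registered). [folklore] -/
theorem rightEdge_mem_S₁₁ : ((107 / 200 : ℝ), (3 / 2 : ℝ)) ∈ S₁₁ := by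
  refine ⟨⟨⟨by norm_num, le_rfl⟩, ⟨by norm_num, by norm_num⟩⟩, by norm_num, ?_⟩
  norm_num

/-- The lower-left corner `(101/200, 6/5)` of the window lies in `W₁₁` and outside `B₁₁ ∪ S₁₁plus` — hence
outside `B₁₁ ∪ S₁₁^□` for every admissible staircase, and outside the target band `U₁₁`. [folklore] -/
theorem corner_mem_diff : ((101 / 200 : ℝ), (6 / 5 : ℝ)) ∈ W₁₁ \ (B₁₁ ∪ S₁₁plus) := by
  refine ⟨⟨⟨le_rfl, by norm_num⟩, ⟨le_rfl, by norm_num⟩⟩, ?_⟩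
  rintro (⟨⟨h1, -⟩, -⟩ | ⟨-, h2, -⟩)
  · norm_num at h1
  · norm_num at h2

/-- For every staircase inside the envelope, the corner lies in `W₁₁ \ (B₁₁ ∪ S₁₁^□)`. [folklore] -/
theorem corner_mem_diff_stair {stair : List BoxQ} (hsub : (⋃ Q ∈ stair, Q.toSet) ⊆ S₁₁plus) :
    ((101 / 200 : ℝ), (6 / 5 : ℝ)) ∈ W₁₁ \ (B₁₁ ∪ ⋃ Q ∈ stair, Q.toSet) :=
  ⟨corner_mem_diff.1, fun h => corner_mem_diff.2 (h.imp id fun h' => hsub h')⟩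

/-- Hence the empty tiling is NOT a strip certificate, for ANY admissible staircase: the `covers` field is not
vacuous. [folklore] -/
theorem not_stripCertificatesL11_nil_cover (stair : List BoxQ) : ¬ StripCertificatesL11 stair [] := by
  intro h
  have := h.covers (corner_mem_diff_stair h.stair_sub)
  simp at this

/-- And the staircase of a strip certificate is never empty (`S₁₁` is non-empty and `stair_sup` covers it).
[folklore] -/
theorem StripCertificatesL11.stair_ne_nil {stair cover : List BoxQ} (h : StripCertificatesL11 stair cover) :
    stair ≠ [] := by
  intro hnil
  have := h.stair_sup rightEdge_mem_S₁₁
  rw [hnil] at this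
  simp at this

/-! ### Non-vacuity of A1–A4 and sanity of the window -/

/-- A1–A4 are satisfiable — e.g. by the generalised-free datum at `(Δσ, Δε) = (1, 2)` of
`MeanFieldDecompositionAB`, which lies outside `W₁₁` — so no `BoxExcluded` / `IsingEnclosure` statement here
is true for the vacuous reason. [folklore] -/
theorem axioms_satisfiable : ∃ D : SigmaEpsilonData, D.SatisfiesBootstrapAxioms ∧ (D.Δσ, D.Δε) ∉ W₁₁ := by
  refine ⟨gffPair 1 (2 * 1), gffLine_satisfiesBootstrapAxioms le_rfl, ?_⟩
  rintro ⟨⟨-, h2⟩, -⟩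
  norm_num at h2

/-! ### The residuals T1 / T4-A of the PRE-REG as Lean legs (tree theorems; no hypothesis introduced) -/

/-- On `W₁₁` the side conditions of the tree's block-identification and termwise theorems hold:
`1/2 < Δσ < 1` and `Δε > Δσ + 1/2`. [folklore] -/
theorem sideConditions_of_mem_W₁₁ {p : ℝ × ℝ} (hp : p ∈ W₁₁) :
    1 / 2 < p.1 ∧ p.1 < 1 ∧ p.1 + 1 / 2 < p.2 := by
  obtain ⟨⟨h1, h2⟩, h3, -⟩ := hp
  exact ⟨by linarith, by linarith, by linarith⟩

/-- The three side conditions `Δσ ≠ Δε`, `4Δσε² ≠ 1`, `Δσ ≠ 1` for a datum in the window. [folklore] -/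
theorem ne_of_mem_W₁₁ (D : SigmaEpsilonData) (hW : (D.Δσ, D.Δε) ∈ W₁₁) :
    D.Δσ ≠ D.Δε ∧ 4 * D.Δσε ^ 2 ≠ 1 ∧ D.Δσ ≠ 1 := by
  obtain ⟨h1, h2, h3⟩ := sideConditions_of_mem_W₁₁ hW
  simp only at h1 h2 h3
  refine ⟨by intro h; linarith, ?_, ne_of_lt h2⟩
  unfold SigmaEpsilonData.Δσε
  have h4 : 1 < 4 * (D.Δσ - D.Δε) ^ 2 := by nlinarith
  exact ne_of_gt h4

/-- **T1 (block identification) on the strip window — a tree theorem, packaged.** For every datum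
satisfying A1–A4 with `(Δσ, Δε) ∈ W₁₁`, every block function IS the explicit Dolan–Osborn /
Hogervorst–Rychkov series block on the open square: `gp i = hrBlock`, `gpm j = hrBlockAB (−Δσε) Δσε`,
`gmm j = hrBlockAB Δσε Δσε` — at every admissible `(Δ, ℓ)`, conserved currents (incl. the stress tensor) and
accidental degeneracies included, for ALL `(a, b)` (`BlockUniquenessLimit`; Kos–Poland–Simmons-Duffin 2014 §4).
[folklore] -/
theorem blocks_eq_hrBlock_of_mem_W₁₁ (D : SigmaEpsilonData) (hD : D.SatisfiesBootstrapAxioms)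
    (hW : (D.Δσ, D.Δε) ∈ W₁₁) :
    (∀ i, ∀ z zb : ℝ, z ∈ Ioo (0 : ℝ) 1 → zb ∈ Ioo (0 : ℝ) 1 →
        D.gp i z zb = hrBlock (D.Δp i) (D.ℓp i) z zb) ∧
      (∀ j, ∀ z zb : ℝ, z ∈ Ioo (0 : ℝ) 1 → zb ∈ Ioo (0 : ℝ) 1 →
        D.gpm j z zb = hrBlockAB (-D.Δσε) D.Δσε (D.Δm j) (D.ℓm j) z zb) ∧
      (∀ j, ∀ z zb : ℝ, z ∈ Ioo (0 : ℝ) 1 → zb ∈ Ioo (0 : ℝ) 1 →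
        D.gmm j z zb = hrBlockAB D.Δσε D.Δσε (D.Δm j) (D.ℓm j) z zb) := by
  obtain ⟨hne, hs, -⟩ := ne_of_mem_W₁₁ D hW
  exact ⟨fun i => hD.gp_eq_hrBlock i, fun j => hD.gpm_eq_hrBlockAB hne hs j,
    fun j => hD.gmm_eq_hrBlockAB hne hs j⟩

/-- **T1 in the evaluators' form «typed block = z-series / κ»** on `W₁₁`: the `(n, j)` `z`-series
`Σ (A_{n,j}(a,b)/λ_ℓ) 𝒫_{Δ+n,j}(x, y)` converges to the block at every real point of the square — even family
(`a = b = 0`, every admissible point), `⟨εσσε⟩` family `gpm` (`a = b = Δσε/2`), `⟨σεσε⟩` family `gmm`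
(`a = −Δσε/2`, `b = Δσε/2`) (`BlockZSeriesABOfLt`, `BlockUniquenessLimit`; Dolan–Osborn 2004 §3
eqs. (3.10)–(3.12)). [folklore] -/
theorem blocks_hasSum_zSeries_of_mem_W₁₁ (D : SigmaEpsilonData) (hD : D.SatisfiesBootstrapAxioms)
    (hW : (D.Δσ, D.Δε) ∈ W₁₁) {x y : ℝ} (hx : x ∈ Ioo (0 : ℝ) 1) (hy : y ∈ Ioo (0 : ℝ) 1) :
    (∀ i, HasSum (hrZTerm (D.Δp i) (D.ℓp i) x y) (D.gp i x y)) ∧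
      (∀ j, HasSum (hrZTermAB (D.Δσε / 2) (D.Δσε / 2) (D.Δm j) (D.ℓm j) x y) (D.gpm j x y)) ∧
      (∀ j, HasSum (hrZTermAB (-D.Δσε / 2) (D.Δσε / 2) (D.Δm j) (D.ℓm j) x y) (D.gmm j x y)) := by
  obtain ⟨hne, hs, hσ1⟩ := ne_of_mem_W₁₁ D hW
  refine ⟨fun i => ?_, fun j => ?_, fun j => ?_⟩
  · exact (hD.1.1 i).hasSum_hrZTerm_of_isAdmissible (hD.sigmaAxioms.isAdmissible3D_p i) hx hy
  · exact (hD.1.2.2 j).hasSum_hrZTermAB_of_lt (hD.bound_lt_Δm hne hs j) rfl hx hy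
  · have h1 : D.ℓm j = 0 → D.Δm j ≠ 1 := by
      intro hℓ hΔ
      have h3 : D.Δm j = D.Δσ := hD.2.2.2.2.1 j hℓ (by rw [hΔ]; norm_num)
      exact hσ1 (h3.symm.trans hΔ)
    exact ((hD.1.2.1 j).hasSum_hrZTermAB_neg_of_lt (hD.bound_lt_Δm hne hs j) h1 (hD.1.2.2 j) hx hy).1

/-- **T4-A on the strip window — how an `excluded` field is discharged by the kernel (S2).** For EVERY tile
`Q ⊆ W₁₁` the tree's abstract certificate theorem `boxExcluded_of_taylorTermwiseObligations` (termwise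
action `appliesTermwise_of_isTaylorAt_of_axioms` inside) turns the termwise obligations of a derivative
functional at a diagonal point `(x, x)` into `BoxExcluded Q`, with no further hypothesis: the window supplies
the side conditions (Kos–Poland–Simmons-Duffin 2014 §3.3 eq. (3.16)). [folklore] -/
theorem boxExcluded_of_obligations_of_subset_W₁₁ {Q : Set (ℝ × ℝ)} (hQ : Q ⊆ W₁₁) {x : ℝ}
    (hx0 : 0 < x) (hx1 : x < 1) (α : CrossingFunctional) (hα : IsTaylorAt α x x) {E₀ : ℝ}
    (hE₀ : 1 < E₀) (h : TaylorTermwiseObligations α Q E₀) : BoxExcluded Q :=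
  boxExcluded_of_taylorTermwiseObligations hx0 hx1 α hα hE₀
    (fun _ hp => sideConditions_of_mem_W₁₁ (hQ hp)) h

end StripL11

end Summit.CriticalPhenomena.Ising3D
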